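import Literature.Geometry.Kaehler.ComplexTorusIntegralHodgeLatticeTopMinimalClassSplitting
import Literature.Geometry.Kaehler.ComplexTorusMinimalClassesUnimodular
import HarnessLib

/-!
# The value group of the top minimal class and the sharp index of the top splitting:
# `[Hdgᵖ(X, ℤ) : ℤγ_p ⊕ γ_p^⊥] · [B(γ_p, H^{2p}(X, ℤ)) : B(γ_p, Hdgᵖ(X, ℤ))] · (p!·d₁⋯d_p)·((g−p)!·d₁⋯d_{g−p}) = g!·d₁⋯d_g`

Layer `Literature/Geometry/Kaehler`, namespace `Literature.Geometry.Kaehler.ComplexTorus`; lane `lit-hodgefound`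
(Track 2 foundations library), seat p09, generation 48, row g48-#6. THEOREMS ONLY (0 definitions); no named fact, net debt 0.
g48-#5 (`ComplexTorusIntegralHodgeLatticeTopMinimalClassSplitting`) proved `J_p · m_p · (p!·d₁⋯d_p)²·(q!·d₁⋯d_q) = g!·d₁⋯d_g` (`2p + q = g`) for the index
`J_p = [Hdgᵖ(X, ℤ) : ℤγ_p ⊕ γ_p^⊥]` of the top splitting and the index `m_p = [ℤ : B(γ_p, Hdgᵖ(X, ℤ))]` of the value group of the minimal class
`γ_p = θ^{∧p}/(p!·d₁⋯d_p)` on the HODGE lattice, `B = ⟨·, γ_q ∧ ·⟩_e` the integral Lefschetz form of `H^{2p}(X, ℤ)`. Here the value group of `γ_p` on the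
WHOLE lattice `H^{2p}(X, ℤ)` is computed — it is `r_p·ℤ` with `r_p·(p!·d₁⋯d_p)·(q!·d₁⋯d_q) = (g−p)!·d₁⋯d_{g−p}`, by the UNIMODULARITY of the complementary
minimal class `γ_{g−p}` (Lange Thm. 2.5.16 / the tree's `ComplexTorusMinimalClassesUnimodular`) — and divided out:

* §1 **`⟨θ^{∧p}, θ^{∧q} ∧ y⟩_e = ⟨θ^{∧(p+q)}, y⟩_e`** (`poincarePairing_wedgePow_wedgePow_wedge`: `Lᵖ ∘ L^q = L^{p+q}` under the cup-product pairing) and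
  **`(p!·d₁⋯d_p)·(q!·d₁⋯d_q)·B(γ_p, y) = ((p+q)!·d₁⋯d_{p+q})·⟨γ_{p+q}, y⟩_e`** for every `y ∈ H^{2p}(X, ℂ)`
  (`content_mul_apply_minimalClass_eq`).
* §2 **THE VALUE GROUP `B(γ_p, H^{2p}(X, ℤ)) = r_p·ℤ`, `r_p·(p!·d₁⋯d_p)·(q!·d₁⋯d_q) = (g−p)!·d₁⋯d_{g−p}`** (`IsPolarizationType.index_range_apply_minimalClass_mul_content_eq`:
  `γ_{g−p}` is unimodular on `H^{2p}(X, ℤ)` and all its values are integers); in particular `(p!·d₁⋯d_p)·(q!·d₁⋯d_q) ∣ (g−p)!·d₁⋯d_{g−p}`.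
* §3 **THE SHARP INDEX FORMULA `J_p · n_p · (p!·d₁⋯d_p)·((g−p)!·d₁⋯d_{g−p}) = g!·d₁⋯d_g`** with `n_p = [B(γ_p, H^{2p}(X, ℤ)) : B(γ_p, Hdgᵖ(X, ℤ))] ≥ 1`
  (`m_p = r_p · n_p`; `IsPolarizationType.index_top_splitting_mul_relIndex_range_mul_content_eq`, data-free `IsPolarizationType.exists_top_splitting_sharp`): the index
  of the top splitting divides the LATTICE BINOMIAL `g!·d₁⋯d_g / ((p!·d₁⋯d_p)·((g−p)!·d₁⋯d_{g−p}))` — for a principal polarisation `J_p · n_p = (g choose p)`, e.g.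
  `[NS(X) : ℤθ ⊕ NS(X)_prim] · n₁ = g`, sharpening g48-#5's bound `J_p ∣ g!·d₁⋯d_g/((p!·d₁⋯d_p)²·(q!·d₁⋯d_q))` by the factor `r_p`.

## References

* [cite: Lange2023AbelianVarietiesComplex, §2.5.3 Thm. 2.5.16, Cor. 2.5.17 (d) (PDF p. 135); §1.5.1 (PDF p. 51); §5.4.1 Thm. 5.4.2 and (5.22)–(5.23) (PDF p. 275); §6.2.4 (PDF p. 310); §7.3.2 (3)]
* [cite: BenoistDebarre2023SmoothSubvarietiesJacobians, §1 (p. 3); §3 proof of Thm. 3.7 (p. 7)]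
* [cite: VoisinHodgeI2002, §6.3.2 Lemma 6.31 (PDF p. 128); §7.1.2 (PDF p. 134)]
* [cite: Kitaoka1993, Ch. 5 Prop. 5.3.3 (proof)]
* [cite: Huybrechts2016K3, Ch. 14 §0.1–§0.2 (PDF p. 333)]
-/

noncomputable section

-- `Module ℂ` / `SMulZeroClass ℂ` synthesis on `E [⋀^Fin k]→L[ℝ] ℂ` (as in `ComplexTorusLefschetzDecomposition`)
set_option maxSynthPendingDepth 3

open Module Function Complex
open LinearMap (BilinForm)
open Literature.LinearAlgebra.Alternating
open Literature.Analysis.Complex (IsOfTypeAt typeSubmodule mem_typeSubmodule_iff_isOfTypeAt)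

namespace Literature.Geometry.Kaehler.ComplexTorus

/-! ## §1 `⟨θ^{∧p}, θ^{∧q} ∧ y⟩ = ⟨θ^{∧(p+q)}, y⟩` and the minimal classes -/

section Shift

variable {ι : Type*} [Fintype ι] [DecidableEq ι] {E : Type*} [NormedAddCommGroup E] [NormedSpace ℂ E]
  (Φ : (ι → ℝ) ≃L[ℝ] E) {n : ℕ}

omit [Fintype ι] in
/-- The orientation sign of a re-typed enumeration. [folklore] -/
private theorem orientationSign_finCongr_trans₉₆ {m : ℕ} (h : m = n) (e : Fin n ≃ ι) :
    orientationSign Φ ((finCongr h).trans e) = orientationSign Φ e := by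
  subst h
  rfl

omit [Fintype ι] in
/-- **`⟨θ^{∧p}, θ^{∧q} ∧ y⟩_e = ⟨θ^{∧(p+q)}, y⟩_e`**: the cup-product pairing only sees the total Lefschetz power (`θ^{∧p} ∧ (θ^{∧q} ∧ y) = θ^{∧(p+q)} ∧ y`,
associativity of `∧`; `⟨γ, δ⟩_e = sign(e)·∫_X γ ∧ δ`). [cite: Lange2023AbelianVarietiesComplex, §6.2.4 (PDF p. 310); §7.3.2] -/
theorem poincarePairing_wedgePow_wedgePow_wedge (θ : E [⋀^Fin 2]→L[ℝ] ℂ) (e : Fin n ≃ ι) {p q m : ℕ} (hn : 2 * p + (2 * q + m) = n)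
    (hn' : 2 * (p + q) + m = n) (y : E [⋀^Fin m]→L[ℝ] ℂ) :
    poincarePairing Φ e hn (wedgePow θ p) ((wedgePow θ q).wedge y) = poincarePairing Φ e hn' (wedgePow θ (p + q)) y := by
  have hE : (finCongr (show 2 * (p + q) + m = 2 * p + (2 * q + m) by ring)).trans ((finCongr hn).trans e) = (finCongr hn').trans e :=
    Equiv.ext fun _ ↦ rfl
  rw [poincarePairing_eq_orientationSign_mul_torusIntegral_wedge Φ e hn, poincarePairing_eq_orientationSign_mul_torusIntegral_wedge Φ e hn',
    orientationSign_finCongr_trans₉₆ Φ hn e, orientationSign_finCongr_trans₉₆ Φ hn' e, wedgePow_wedge_wedgePow_wedge θ p q y,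
    ← torusIntegral_finCongr_trans Φ, hE]

variable {Φ} {j : ℕ} {η : E [⋀^Fin 2]→L[ℝ] ℝ} {d : Fin (j + 2) → ℕ}

omit [Fintype ι] in
/-- **`(p!·d₁⋯d_p)·(q!·d₁⋯d_q)·⟨γ_p, γ_q ∧ y⟩_e = ((p+q)!·d₁⋯d_{p+q})·⟨γ_{p+q}, y⟩_e`** for the minimal classes `γ_m = θ^{∧m}/(m!·d₁⋯d_m)` and any form `y`.
[cite: Lange2023AbelianVarietiesComplex, §2.5.3 Thm. 2.5.16 (PDF p. 135); §6.2.4 (PDF p. 310)] [cite: BenoistDebarre2023SmoothSubvarietiesJacobians, §1 (p. 3)] -/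
theorem content_mul_poincarePairing_minimalClass_wedge_eq {p q m : ℕ} (hp : p ≤ j + 2) (hq : q ≤ j + 2) (hpq : p + q ≤ j + 2)
    {γp : E [⋀^Fin (2 * p)]→L[ℝ] ℂ} (hγp : wedgePow (ofRealForm η) p = ((p.factorial * ∏ i : Fin p, d (Fin.castLE hp i) : ℕ) : ℂ) • γp)
    {γq : E [⋀^Fin (2 * q)]→L[ℝ] ℂ} (hγq : wedgePow (ofRealForm η) q = ((q.factorial * ∏ i : Fin q, d (Fin.castLE hq i) : ℕ) : ℂ) • γq)
    {γpq : E [⋀^Fin (2 * (p + q))]→L[ℝ] ℂ}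
    (hγpq : wedgePow (ofRealForm η) (p + q) = (((p + q).factorial * ∏ i : Fin (p + q), d (Fin.castLE hpq i) : ℕ) : ℂ) • γpq)
    (e : Fin n ≃ ι) (hn : 2 * p + (2 * q + m) = n) (hn' : 2 * (p + q) + m = n) (y : E [⋀^Fin m]→L[ℝ] ℂ) :
    (((p.factorial * ∏ i : Fin p, d (Fin.castLE hp i)) * (q.factorial * ∏ i : Fin q, d (Fin.castLE hq i)) : ℕ) : ℂ) *
        poincarePairing Φ e hn γp (γq.wedge y) =
      (((p + q).factorial * ∏ i : Fin (p + q), d (Fin.castLE hpq i) : ℕ) : ℂ) * poincarePairing Φ e hn' γpq y := by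
  have h := poincarePairing_wedgePow_wedgePow_wedge Φ (ofRealForm η) e hn hn' y
  rw [hγp, hγq, hγpq, map_smul, LinearMap.smul_apply, wedge_smul_left_complex, map_smul, map_smul, LinearMap.smul_apply, smul_eq_mul,
    smul_eq_mul, smul_eq_mul] at h
  rw [← h]
  push_cast
  ring

omit [Fintype ι] in
/-- **`(p!·d₁⋯d_p)·(q!·d₁⋯d_q)·B(γ_p, y) = ((p+q)!·d₁⋯d_{p+q})·⟨γ_{p+q}, y⟩_e`** for the integral Lefschetz form `B = ⟨·, γ_q ∧ ·⟩_e` of `H^{2p}(X, ℤ)` and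
`y ∈ H^{2p}(X, ℤ)`. [cite: Lange2023AbelianVarietiesComplex, §2.5.3 Thm. 2.5.16 (PDF p. 135); §6.2.4 (PDF p. 310)] [cite: VoisinHodgeI2002, §7.1.2 (PDF p. 134)] -/
theorem content_mul_apply_minimalClass_eq {p q : ℕ} (hp : p ≤ j + 2) (hq : q ≤ j + 2) (hpq : p + q ≤ j + 2)
    {γq : E [⋀^Fin (2 * q)]→L[ℝ] ℂ} (hγq : wedgePow (ofRealForm η) q = ((q.factorial * ∏ i : Fin q, d (Fin.castLE hq i) : ℕ) : ℂ) • γq)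
    {γpq : E [⋀^Fin (2 * (p + q))]→L[ℝ] ℂ}
    (hγpq : wedgePow (ofRealForm η) (p + q) = (((p + q).factorial * ∏ i : Fin (p + q), d (Fin.castLE hpq i) : ℕ) : ℂ) • γpq)
    (e : Fin n ≃ ι) (hn : 2 * p + (2 * q + 2 * p) = n) (hn' : 2 * (p + q) + 2 * p = n) {B : BilinForm ℤ ↥(integralForms Φ (2 * p))}
    (hB : ∀ x y : ↥(integralForms Φ (2 * p)),
      ((B x y : ℤ) : ℂ) = poincarePairing Φ e hn (x : E [⋀^Fin (2 * p)]→L[ℝ] ℂ) (γq.wedge (y : E [⋀^Fin (2 * p)]→L[ℝ] ℂ)))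
    (γpZ : ↥(integralForms Φ (2 * p)))
    (hγpZ : wedgePow (ofRealForm η) p = ((p.factorial * ∏ i : Fin p, d (Fin.castLE hp i) : ℕ) : ℂ) • (γpZ : E [⋀^Fin (2 * p)]→L[ℝ] ℂ))
    (y : ↥(integralForms Φ (2 * p))) :
    (((p.factorial * ∏ i : Fin p, d (Fin.castLE hp i)) * (q.factorial * ∏ i : Fin q, d (Fin.castLE hq i)) : ℕ) : ℂ) * (B γpZ y : ℤ) =
      (((p + q).factorial * ∏ i : Fin (p + q), d (Fin.castLE hpq i) : ℕ) : ℂ) * poincarePairing Φ e hn' γpq (y : E [⋀^Fin (2 * p)]→L[ℝ] ℂ) := by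
  rw [hB]
  exact content_mul_poincarePairing_minimalClass_wedge_eq hp hq hpq hγpZ hγq hγpq e hn hn' _

end Shift

/-! ## §2 The value group of `γ_p` on `H^{2p}(X, ℤ)`: `B(γ_p, H^{2p}(X, ℤ)) = r_p·ℤ`, `r_p·(p!·d₁⋯d_p)·(q!·d₁⋯d_q) = (p+q)!·d₁⋯d_{p+q}` -/

section ValueGroup

variable {ι : Type*} [Fintype ι] [DecidableEq ι] {E : Type*} [NormedAddCommGroup E] [NormedSpace ℂ E]
  {Φ : (ι → ℝ) ≃L[ℝ] E} {j n p q : ℕ} {η : E [⋀^Fin 2]→L[ℝ] ℝ} {d : Fin (j + 2) → ℕ}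

/-- **THE VALUE GROUP OF THE MINIMAL CLASS ON THE WHOLE LATTICE: `B(γ_p, H^{2p}(X, ℤ)) = r_p·ℤ` with `r_p·(p!·d₁⋯d_p)·(q!·d₁⋯d_q) = (p+q)!·d₁⋯d_{p+q}`**
(`(p!·d₁⋯d_p)(q!·d₁⋯d_q)·B(γ_p, y) = ((p+q)!·d₁⋯d_{p+q})·⟨γ_{p+q}, y⟩` and the minimal class `γ_{p+q}` is UNIMODULAR on `H^{2p}(X, ℤ)`: its values are all the
integers); in particular `0 < r_p = [ℤ : B(γ_p, H^{2p}(X, ℤ))]` and `(p!·d₁⋯d_p)·(q!·d₁⋯d_q) ∣ (p+q)!·d₁⋯d_{p+q}`.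
[cite: Lange2023AbelianVarietiesComplex, §2.5.3 Thm. 2.5.16, Cor. 2.5.17 (PDF p. 135); §1.5.1 (PDF p. 51); §6.2.4 (PDF p. 310)] [cite: BenoistDebarre2023SmoothSubvarietiesJacobians, §1 (p. 3); §3 proof of Thm. 3.7 (p. 7)] -/
theorem IsPolarizationType.index_range_apply_minimalClass_mul_content_eq (hd : IsPolarizationType Φ η d) (hη : IsRiemannForm Φ η)
    (hp : p ≤ j + 2) (hq : q ≤ j + 2) (hpq : p + q ≤ j + 2)
    {γq : E [⋀^Fin (2 * q)]→L[ℝ] ℂ} (hγq : wedgePow (ofRealForm η) q = ((q.factorial * ∏ i : Fin q, d (Fin.castLE hq i) : ℕ) : ℂ) • γq)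
    (e : Fin n ≃ ι) (hn : 2 * p + (2 * q + 2 * p) = n) {B : BilinForm ℤ ↥(integralForms Φ (2 * p))}
    (hB : ∀ x y : ↥(integralForms Φ (2 * p)),
      ((B x y : ℤ) : ℂ) = poincarePairing Φ e hn (x : E [⋀^Fin (2 * p)]→L[ℝ] ℂ) (γq.wedge (y : E [⋀^Fin (2 * p)]→L[ℝ] ℂ)))
    (γpZ : ↥(integralForms Φ (2 * p)))
    (hγpZ : wedgePow (ofRealForm η) p = ((p.factorial * ∏ i : Fin p, d (Fin.castLE hp i) : ℕ) : ℂ) • (γpZ : E [⋀^Fin (2 * p)]→L[ℝ] ℂ)) :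
    (LinearMap.range (B γpZ)).toAddSubgroup.index * ((p.factorial * ∏ i : Fin p, d (Fin.castLE hp i)) * (q.factorial * ∏ i : Fin q, d (Fin.castLE hq i))) = ((p + q).factorial * ∏ i : Fin (p + q), d (Fin.castLE hpq i)) ∧
      0 < (LinearMap.range (B γpZ)).toAddSubgroup.index := by
  obtain ⟨γpq, hγpqZ, hγpq⟩ := hd.exists_mem_integralForms_wedgePow_eq_content_smul hpq
  have hn' : 2 * (p + q) + 2 * p = n := by omega
  -- the unimodular partner of `γ_{p+q}`
  obtain ⟨y₁, hy₁Z, hy₁⟩ := hd.exists_poincarePairing_eq_one_of_wedgePow_eq_content_smul hη hpq hγpqZ hγpq e hn'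
  have hC0 : ((((p.factorial * ∏ i : Fin p, d (Fin.castLE hp i)) * (q.factorial * ∏ i : Fin q, d (Fin.castLE hq i)) : ℕ)) : ℤ) ≠ 0 := by
    exact_mod_cast (Nat.mul_pos (Nat.mul_pos (Nat.factorial_pos p) (Finset.prod_pos fun i _ ↦ hd.pos hη _))
      (Nat.mul_pos (Nat.factorial_pos q) (Finset.prod_pos fun i _ ↦ hd.pos hη _))).ne'
  have key : ∀ y : ↥(integralForms Φ (2 * p)), ∃ c : ℤ, ((((p.factorial * ∏ i : Fin p, d (Fin.castLE hp i)) * (q.factorial * ∏ i : Fin q, d (Fin.castLE hq i)) : ℕ)) : ℤ) * B γpZ y = ((((p + q).factorial * ∏ i : Fin (p + q), d (Fin.castLE hpq i)) : ℕ) : ℤ) * c ∧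
      poincarePairing Φ e hn' γpq (y : E [⋀^Fin (2 * p)]→L[ℝ] ℂ) = c := fun y ↦ by
    obtain ⟨c, hc⟩ := poincarePairing_mem_range_int Φ e hn' hγpqZ y.2
    refine ⟨c, ?_, hc⟩
    apply Int.cast_injective (α := ℂ)
    have h := content_mul_apply_minimalClass_eq hp hq hpq hγq hγpq e hn hn' hB γpZ hγpZ y
    rw [hc] at h
    push_cast at h ⊢
    linear_combination h
  obtain ⟨c₁, hc₁, hc₁'⟩ := key ⟨y₁, hy₁Z⟩
  have hc₁1 : c₁ = 1 := by exact_mod_cast hc₁'.symm.trans hy₁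
  rw [hc₁1, mul_one] at hc₁
  -- `hc₁ : (p!·d₁⋯d_p)(q!·d₁⋯d_q) · r = (p+q)!·d₁⋯d_{p+q}` with `r = B(γ_p, y₁)`; the value group is `r·ℤ`
  have hrange : (LinearMap.range (B γpZ)).toAddSubgroup = AddSubgroup.zmultiples (B γpZ ⟨y₁, hy₁Z⟩) := by
    refine le_antisymm (fun z hz ↦ ?_) (AddSubgroup.zmultiples_le_of_mem ⟨⟨y₁, hy₁Z⟩, rfl⟩)
    obtain ⟨y, rfl⟩ := LinearMap.mem_range.1 ((Submodule.mem_toAddSubgroup _).1 hz)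
    obtain ⟨c, hc, -⟩ := key y
    rw [← hc₁, mul_assoc _ (B γpZ ⟨y₁, hy₁Z⟩) c] at hc
    refine AddSubgroup.mem_zmultiples_iff.2 ⟨c, ?_⟩
    rw [zsmul_eq_mul, Int.cast_id, mul_comm]
    exact (mul_left_cancel₀ hC0 hc).symm
  have habs := congrArg Int.natAbs hc₁
  simp only [Int.natAbs_mul, Int.natAbs_natCast] at habs
  have hpos : 0 < ((p + q).factorial * ∏ i : Fin (p + q), d (Fin.castLE hpq i)) := Nat.mul_pos (Nat.factorial_pos _) (Finset.prod_pos fun i _ ↦ hd.pos hη _)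
  rw [hrange, Int.index_zmultiples]
  refine ⟨by rw [mul_comm]; exact habs, Nat.pos_of_ne_zero fun h0 ↦ ?_⟩
  rw [h0, mul_zero] at habs
  exact hpos.ne' habs.symm

end ValueGroup

/-! ## §3 The sharp index formula `J_p · n_p · (p!·d₁⋯d_p)·((g−p)!·d₁⋯d_{g−p}) = g!·d₁⋯d_g` -/

section Sharp

/-- The arithmetic of §3: `J·m·(C_p²·C_q) = C_g`, `m = n·r`, `r·(C_p·C_q) = C_{p+q}` give `J·n·(C_p·C_{p+q}) = C_g`. [folklore] -/
private theorem arith₉₆ {J m n r Cp Cq Cpq Cg : ℕ} (h5 : J * m * (Cp ^ 2 * Cq) = Cg) (hm : m = n * r) (hr : r * (Cp * Cq) = Cpq) :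
    J * n * (Cp * Cpq) = Cg := by
  subst hm
  rw [← h5, ← hr]
  ring

variable {ι : Type*} [Fintype ι] [DecidableEq ι] {E : Type*} [NormedAddCommGroup E] [NormedSpace ℂ E]
  {Φ : (ι → ℝ) ≃L[ℝ] E} {j n p q : ℕ} {η : E [⋀^Fin 2]→L[ℝ] ℝ} {d : Fin (j + 2) → ℕ}

/-- **THE SHARP INDEX FORMULA OF THE TOP SPLITTING:
`[Hdgᵖ(X, ℤ) : ℤγ_p ⊕ γ_p^⊥] · [B(γ_p, H^{2p}(X, ℤ)) : B(γ_p, Hdgᵖ(X, ℤ))] · (p!·d₁⋯d_p)·((g−p)!·d₁⋯d_{g−p}) = g!·d₁⋯d_g`** (`2p + q = g`, `g − p = p + q`;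
`M = Hdgᵖ(X, ℤ)`, `B_M = B∣M`, `Λ = ℤγ_p`): g48-#5's `J_p · m_p · (p!·d₁⋯d_p)²·(q!·d₁⋯d_q) = g!·d₁⋯d_g` with `m_p = [ℤ : B(γ_p, Hdgᵖ)] = r_p · n_p` and §2's
`r_p·(p!·d₁⋯d_p)(q!·d₁⋯d_q) = (g−p)!·d₁⋯d_{g−p}`; the relative index `n_p ≥ 1`. Hence **`J_p` divides the lattice binomial `g!·d₁⋯d_g/((p!·d₁⋯d_p)((g−p)!·d₁⋯d_{g−p}))`**.
[cite: Lange2023AbelianVarietiesComplex, §5.4.1 Thm. 5.4.2 and (5.22)–(5.23) (PDF p. 275); §2.5.3 Thm. 2.5.16, Cor. 2.5.17 (d) (PDF p. 135); §7.3.2 (3)] [cite: Kitaoka1993, Ch. 5 Prop. 5.3.3 (proof)] [cite: Huybrechts2016K3, Ch. 14 §0.1–§0.2] -/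
theorem IsPolarizationType.index_top_splitting_mul_relIndex_range_mul_content_eq (hd : IsPolarizationType Φ η d) (hη : IsRiemannForm Φ η)
    (hp : p ≤ j + 2) (hq : q ≤ j + 2) (hpq : p + q ≤ j + 2) (hkq : 2 * p + q = j + 2)
    {γq : E [⋀^Fin (2 * q)]→L[ℝ] ℂ} (hγq : wedgePow (ofRealForm η) q = ((q.factorial * ∏ i : Fin q, d (Fin.castLE hq i) : ℕ) : ℂ) • γq)
    (e : Fin n ≃ ι) (hn : 2 * p + (2 * q + 2 * p) = n) {B : BilinForm ℤ ↥(integralForms Φ (2 * p))}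
    (hB : ∀ x y : ↥(integralForms Φ (2 * p)),
      ((B x y : ℤ) : ℂ) = poincarePairing Φ e hn (x : E [⋀^Fin (2 * p)]→L[ℝ] ℂ) (γq.wedge (y : E [⋀^Fin (2 * p)]→L[ℝ] ℂ)))
    (γM : ↥(AddSubgroup.toIntSubmodule ((integralHodgeClassesIn Φ (2 * p) p).addSubgroupOf (integralForms Φ (2 * p)))))
    (hγM : wedgePow (ofRealForm η) p = ((p.factorial * ∏ i : Fin p, d (Fin.castLE hp i) : ℕ) : ℂ) •
      (((γM : ↥(AddSubgroup.toIntSubmodule ((integralHodgeClassesIn Φ (2 * p) p).addSubgroupOf (integralForms Φ (2 * p))))) :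
        ↥(integralForms Φ (2 * p))) : E [⋀^Fin (2 * p)]→L[ℝ] ℂ))
    (Λ : Submodule ℤ ↥(AddSubgroup.toIntSubmodule ((integralHodgeClassesIn Φ (2 * p) p).addSubgroupOf (integralForms Φ (2 * p)))))
    (hΛ : ∀ x, x ∈ Λ ↔ ∃ a : ℤ, a • γM = x) :
    (Λ ⊔ (B.restrict (AddSubgroup.toIntSubmodule ((integralHodgeClassesIn Φ (2 * p) p).addSubgroupOf (integralForms Φ (2 * p))))).orthogonal Λ).toAddSubgroup.index *
          ((LinearMap.range (B.restrict (AddSubgroup.toIntSubmodule ((integralHodgeClassesIn Φ (2 * p) p).addSubgroupOf (integralForms Φ (2 * p)))) γM)).toAddSubgroup.relIndex (LinearMap.range (B (γM : ↥(integralForms Φ (2 * p))))).toAddSubgroup) *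
        ((p.factorial * ∏ i : Fin p, d (Fin.castLE hp i)) * ((p + q).factorial * ∏ i : Fin (p + q), d (Fin.castLE hpq i))) = (j + 2).factorial * ∏ i, d i ∧
      0 < ((LinearMap.range (B.restrict (AddSubgroup.toIntSubmodule ((integralHodgeClassesIn Φ (2 * p) p).addSubgroupOf (integralForms Φ (2 * p)))) γM)).toAddSubgroup.relIndex (LinearMap.range (B (γM : ↥(integralForms Φ (2 * p))))).toAddSubgroup) ∧
      (LinearMap.range (B.restrict (AddSubgroup.toIntSubmodule ((integralHodgeClassesIn Φ (2 * p) p).addSubgroupOf (integralForms Φ (2 * p)))) γM)).toAddSubgroup.index =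
        ((LinearMap.range (B.restrict (AddSubgroup.toIntSubmodule ((integralHodgeClassesIn Φ (2 * p) p).addSubgroupOf (integralForms Φ (2 * p)))) γM)).toAddSubgroup.relIndex (LinearMap.range (B (γM : ↥(integralForms Φ (2 * p))))).toAddSubgroup) *
          (LinearMap.range (B (γM : ↥(integralForms Φ (2 * p))))).toAddSubgroup.index := by
  have hg : p + (q + p) = j + 2 := by omega
  have h5 := hd.index_top_splitting_mul_index_range_mul_content_eq hη hp hq hg hγq e hn hB γM hγM Λ hΛ
  have hr := hd.index_range_apply_minimalClass_mul_content_eq hη hp hq hpq hγq e hn hB (γM : ↥(integralForms Φ (2 * p))) hγM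
  have hle : (LinearMap.range (B.restrict (AddSubgroup.toIntSubmodule ((integralHodgeClassesIn Φ (2 * p) p).addSubgroupOf (integralForms Φ (2 * p)))) γM)).toAddSubgroup ≤
      (LinearMap.range (B (γM : ↥(integralForms Φ (2 * p))))).toAddSubgroup := fun z hz ↦ by
    obtain ⟨x, rfl⟩ := LinearMap.mem_range.1 ((Submodule.mem_toAddSubgroup _).1 hz)
    exact (Submodule.mem_toAddSubgroup _).2 (LinearMap.mem_range.2 ⟨(x : ↥(integralForms Φ (2 * p))), rfl⟩)
  have hm : (LinearMap.range (B.restrict (AddSubgroup.toIntSubmodule ((integralHodgeClassesIn Φ (2 * p) p).addSubgroupOf (integralForms Φ (2 * p)))) γM)).toAddSubgroup.index =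
      ((LinearMap.range (B.restrict (AddSubgroup.toIntSubmodule ((integralHodgeClassesIn Φ (2 * p) p).addSubgroupOf (integralForms Φ (2 * p)))) γM)).toAddSubgroup.relIndex (LinearMap.range (B (γM : ↥(integralForms Φ (2 * p))))).toAddSubgroup) *
        (LinearMap.range (B (γM : ↥(integralForms Φ (2 * p))))).toAddSubgroup.index := (AddSubgroup.relIndex_mul_index hle).symm
  refine ⟨arith₉₆ h5.1 hm hr.1, Nat.pos_of_ne_zero fun h0 ↦ ?_, hm⟩
  rw [h0, zero_mul] at hm
  exact h5.2.2.2.ne' hm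

/-- **Principal polarisation: `[Hdgᵖ(X, ℤ) : ℤγ_p ⊕ γ_p^⊥] · n_p = (g choose p)`** (`γ_p = θ^{∧p}/p!`; e.g. `[NS(X) : ℤθ ⊕ NS(X)_prim] · n₁ = g`).
[cite: Lange2023AbelianVarietiesComplex, §5.4.1 (5.22)–(5.23) (PDF p. 275); §2.5.3 Cor. 2.5.17 (d) (PDF p. 135)] [cite: BenoistDebarre2023SmoothSubvarietiesJacobians, §1 (p. 3)] -/
theorem IsPolarizationType.index_top_splitting_mul_relIndex_range_eq_choose (hd : IsPolarizationType Φ η d) (hη : IsRiemannForm Φ η)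
    (h1 : ∀ i, d i = 1) (hp : p ≤ j + 2) (hq : q ≤ j + 2) (hpq : p + q ≤ j + 2) (hkq : 2 * p + q = j + 2)
    {γq : E [⋀^Fin (2 * q)]→L[ℝ] ℂ} (hγq : wedgePow (ofRealForm η) q = ((q.factorial * ∏ i : Fin q, d (Fin.castLE hq i) : ℕ) : ℂ) • γq)
    (e : Fin n ≃ ι) (hn : 2 * p + (2 * q + 2 * p) = n) {B : BilinForm ℤ ↥(integralForms Φ (2 * p))}
    (hB : ∀ x y : ↥(integralForms Φ (2 * p)),
      ((B x y : ℤ) : ℂ) = poincarePairing Φ e hn (x : E [⋀^Fin (2 * p)]→L[ℝ] ℂ) (γq.wedge (y : E [⋀^Fin (2 * p)]→L[ℝ] ℂ)))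
    (γM : ↥(AddSubgroup.toIntSubmodule ((integralHodgeClassesIn Φ (2 * p) p).addSubgroupOf (integralForms Φ (2 * p)))))
    (hγM : wedgePow (ofRealForm η) p = ((p.factorial * ∏ i : Fin p, d (Fin.castLE hp i) : ℕ) : ℂ) •
      (((γM : ↥(AddSubgroup.toIntSubmodule ((integralHodgeClassesIn Φ (2 * p) p).addSubgroupOf (integralForms Φ (2 * p))))) :
        ↥(integralForms Φ (2 * p))) : E [⋀^Fin (2 * p)]→L[ℝ] ℂ))
    (Λ : Submodule ℤ ↥(AddSubgroup.toIntSubmodule ((integralHodgeClassesIn Φ (2 * p) p).addSubgroupOf (integralForms Φ (2 * p)))))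
    (hΛ : ∀ x, x ∈ Λ ↔ ∃ a : ℤ, a • γM = x) :
    (Λ ⊔ (B.restrict (AddSubgroup.toIntSubmodule ((integralHodgeClassesIn Φ (2 * p) p).addSubgroupOf (integralForms Φ (2 * p))))).orthogonal Λ).toAddSubgroup.index *
        ((LinearMap.range (B.restrict (AddSubgroup.toIntSubmodule ((integralHodgeClassesIn Φ (2 * p) p).addSubgroupOf (integralForms Φ (2 * p)))) γM)).toAddSubgroup.relIndex (LinearMap.range (B (γM : ↥(integralForms Φ (2 * p))))).toAddSubgroup) = (j + 2).choose p := by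
  have h := (hd.index_top_splitting_mul_relIndex_range_mul_content_eq hη hp hq hpq hkq hγq e hn hB γM hγM Λ hΛ).1
  simp only [h1, Finset.prod_const_one, mul_one] at h
  have hch := Nat.choose_mul_factorial_mul_factorial (show p ≤ j + 2 from hp)
  rw [show j + 2 - p = p + q by omega] at hch
  -- `h : J·n·(p!·(p+q)!) = (j+2)!`, `hch : choose · p! · (p+q)! = (j+2)!`
  have hne : p.factorial * (p + q).factorial ≠ 0 := (Nat.mul_pos (Nat.factorial_pos _) (Nat.factorial_pos _)).ne'
  apply Nat.eq_of_mul_eq_mul_right (Nat.pos_of_ne_zero hne)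
  rw [h, ← hch, mul_assoc]

/-- **THE SHARP TOP SPLITTING, DATA-FREE** (`2p + q = g`): there are the minimal class `γ_p ∈ Hdgᵖ(X, ℤ)` and a symmetric integral Lefschetz form `B = ⟨·, γ_q ∧ ·⟩_e` on
`H^{2p}(X, ℤ)` with value group `B(γ_p, H^{2p}(X, ℤ))` of index `r_p`, `r_p·(p!·d₁⋯d_p)(q!·d₁⋯d_q) = (g−p)!·d₁⋯d_{g−p}`, such that for the line `Λ = ℤγ_p ⊆ M = Hdgᵖ(X, ℤ)`:
`[M : Λ ⊕ Λ^⊥] · [B(γ_p, H^{2p}(X, ℤ)) : B(γ_p, M)] · (p!·d₁⋯d_p)·((g−p)!·d₁⋯d_{g−p}) = g!·d₁⋯d_g` with both indices positive.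
[cite: Lange2023AbelianVarietiesComplex, §5.4.1 Thm. 5.4.2 and (5.22)–(5.23) (PDF p. 275); §2.5.3 Thm. 2.5.16, Cor. 2.5.17 (d) (PDF p. 135); §7.3.2 (3)] [cite: Kitaoka1993, Ch. 5 Prop. 5.3.3 (proof)] [cite: Huybrechts2016K3, Ch. 14 §0.1–§0.2] -/
theorem IsPolarizationType.exists_top_splitting_sharp (hd : IsPolarizationType Φ η d) (hη : IsRiemannForm Φ η) (hp : p ≤ j + 2) (hq : q ≤ j + 2)
    (hpq : p + q ≤ j + 2) (hkq : 2 * p + q = j + 2) :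
    ∃ (γM : ↥(AddSubgroup.toIntSubmodule ((integralHodgeClassesIn Φ (2 * p) p).addSubgroupOf (integralForms Φ (2 * p)))))
      (B : BilinForm ℤ ↥(integralForms Φ (2 * p))),
      wedgePow (ofRealForm η) p = ((p.factorial * ∏ i : Fin p, d (Fin.castLE hp i) : ℕ) : ℂ) •
        (((γM : ↥(AddSubgroup.toIntSubmodule ((integralHodgeClassesIn Φ (2 * p) p).addSubgroupOf (integralForms Φ (2 * p))))) :
          ↥(integralForms Φ (2 * p))) : E [⋀^Fin (2 * p)]→L[ℝ] ℂ) ∧ B.IsSymm ∧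
      (LinearMap.range (B (γM : ↥(integralForms Φ (2 * p))))).toAddSubgroup.index * ((p.factorial * ∏ i : Fin p, d (Fin.castLE hp i)) * (q.factorial * ∏ i : Fin q, d (Fin.castLE hq i))) = ((p + q).factorial * ∏ i : Fin (p + q), d (Fin.castLE hpq i)) ∧
      ∀ (Λ : Submodule ℤ ↥(AddSubgroup.toIntSubmodule ((integralHodgeClassesIn Φ (2 * p) p).addSubgroupOf (integralForms Φ (2 * p))))),
        (∀ x, x ∈ Λ ↔ ∃ a : ℤ, a • γM = x) →
        (Λ ⊔ (B.restrict (AddSubgroup.toIntSubmodule ((integralHodgeClassesIn Φ (2 * p) p).addSubgroupOf (integralForms Φ (2 * p))))).orthogonal Λ).toAddSubgroup.index *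
              ((LinearMap.range (B.restrict (AddSubgroup.toIntSubmodule ((integralHodgeClassesIn Φ (2 * p) p).addSubgroupOf (integralForms Φ (2 * p)))) γM)).toAddSubgroup.relIndex (LinearMap.range (B (γM : ↥(integralForms Φ (2 * p))))).toAddSubgroup) *
            ((p.factorial * ∏ i : Fin p, d (Fin.castLE hp i)) * ((p + q).factorial * ∏ i : Fin (p + q), d (Fin.castLE hpq i))) = (j + 2).factorial * ∏ i, d i ∧
          0 < (Λ ⊔ (B.restrict (AddSubgroup.toIntSubmodule ((integralHodgeClassesIn Φ (2 * p) p).addSubgroupOf (integralForms Φ (2 * p))))).orthogonal Λ).toAddSubgroup.index ∧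
          0 < ((LinearMap.range (B.restrict (AddSubgroup.toIntSubmodule ((integralHodgeClassesIn Φ (2 * p) p).addSubgroupOf (integralForms Φ (2 * p)))) γM)).toAddSubgroup.relIndex (LinearMap.range (B (γM : ↥(integralForms Φ (2 * p))))).toAddSubgroup) := by
  refine (hd.exists_minimalClass_mem_toIntSubmodule hη hp).elim fun γM hγM ↦ ?_
  refine (hd.exists_mem_integralForms_wedgePow_eq_content_smul hq).elim fun γq hγq' ↦ ?_
  have hγqZ := hγq'.1
  have hγq := hγq'.2
  have hcard : Fintype.card ι = 2 * p + (2 * q + 2 * p) := by rw [hd.card_eq]; omega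
  let e : Fin (2 * p + (2 * q + 2 * p)) ≃ ι := (Fintype.equivFinOfCardEq hcard).symm
  refine (exists_bilinForm_eq_poincarePairing_wedge_of_degree Φ hγqZ e rfl).elim fun B hB ↦ ?_
  have hg : p + (q + p) = j + 2 := by omega
  refine ⟨γM, B, hγM, hd.isSymm_of_eq_poincarePairing_wedge_of_even hη (even_two_mul p) hkq hq hγq e rfl hB,
    (hd.index_range_apply_minimalClass_mul_content_eq hη hp hq hpq hγq e rfl hB (γM : ↥(integralForms Φ (2 * p))) hγM).1, fun Λ hΛ ↦ ?_⟩
  have h1 := hd.index_top_splitting_mul_relIndex_range_mul_content_eq hη hp hq hpq hkq hγq e rfl hB γM hγM Λ hΛ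
  have h2 := hd.index_top_splitting_mul_index_range_mul_content_eq hη hp hq hg hγq e rfl hB γM hγM Λ hΛ
  refine ⟨?_, ?_, ?_⟩
  · exact h1.1
  · exact h2.2.2.1
  · exact h1.2.1

end Sharp

end Literature.Geometry.Kaehler.ComplexTorus

end
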